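import Literature.AlgebraicGeometry.HodgeTheory.CyclicCoverNodalSurfaceSingular
import Literature.AlgebraicGeometry.Motives.UniversalHypersurfaceRegularLocusChart
import HarnessLib

/-!
# The node neighbourhood in `𝒴(ℂ)` and compactness of the support region of the cut-off fields

Family `hodge`, layer `Literature/AlgebraicGeometry/HodgeTheory`; step A1b-γ(iii-b) of the programme discharging
`HodgeTheory/CyclicCoverNodalMeridianLocalMonodromyBound`. The NODE NEIGHBOURHOOD `N_η ⊆ 𝒴(ℂ)` is the open set of points whose homogeneous
coordinates lie in the chart `x₂ ≠ 0` with affine coordinates of norm `< η`. By `CyclicCoverNodalSurfaceSingular` every fibre-singular point over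
the coefficient vector `b₀` of `x₃^p − f₁` lies in `N_η`; by properness (`Motives/UniversalHypersurfaceTotalSpaceOverProper`) the same holds over a
neighbourhood `V` of `b₀`, and for a compact `K ⊆ V` the region `{Q ∈ 𝒴°(ℂ) | b(Q) ∈ K, Q ∉ N_η}` — which will carry the support of the cut-off
lifted fields — is COMPACT.

* `nodeNbhd p η`, `isOpen_nodeNbhd`, `mem_nodeNbhd_of_hypersurfacePoint_eq_node`;
* `map_mem_nodeNbhd_iff` — for `Q ∈ 𝒴°(ℂ)`: `ι(Q) ∈ N_η ↔ Q ∈ 𝒴°(ℂ)₂ ∧ ‖y(Q)‖ < η`;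
* `exists_coeff_nhds_singular_subset_nodeNbhd` — an open `V ∋ b₀` over which all fibre-singular points lie in `N_η`;
* `isCompact_supportRegion` — `{Q | b(Q) ∈ K ∧ ι(Q) ∉ N_η}` is compact for compact `K ⊆ V`.

Everything is proved; the one definition is concrete; no named facts.

## References

* [CarlsonToledo1999] J. A. Carlson, D. Toledo, Duke Math. J. 97 (1999), §6 (kdoublept).
* [LeeSmoothManifolds2013] J. M. Lee, Introduction to Smooth Manifolds (2013), Thm. 9.16 (compact support ⇒ completeness; the region built here).
-/

noncomputable section

open CategoryTheory AlgebraicGeometry MvPolynomial TopologicalSpace Set Topology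
open scoped LinearAlgebra.Projectivization
open Literature.AlgebraicGeometry.Motives Literature.AlgebraicGeometry.Motives.UniversalHypersurface
open Literature.AlgebraicGeometry.HodgeTheory.UniversalHypersurface Literature.NumberTheory.Transcendental

namespace Literature.AlgebraicGeometry.HodgeTheory

variable (p : ℕ) (η : ℝ)

/-- **The node neighbourhood `N_η ⊆ 𝒴(ℂ)`**: homogeneous coordinates in the chart `x₂ ≠ 0` with affine coordinates of norm `< η`.
[cite: CarlsonToledo1999, §6 (kdoublept)] -/
def nodeNbhd : Set (ComplexPoints (totalSpaceOver ℂ 2 p)) :=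
  {P | hypersurfacePoint (totalOverToProjectiveSpace ℂ 2 p) P ∈ (Projectivization.stdChart (𝕜 := ℂ) (2 : Fin 4)).source ∧
    ‖Projectivization.stdChart (𝕜 := ℂ) (2 : Fin 4) (hypersurfacePoint (totalOverToProjectiveSpace ℂ 2 p) P)‖ < η}

/-- `N_η` is open. [cite: CarlsonToledo1999, §6] -/
theorem isOpen_nodeNbhd : IsOpen (nodeNbhd p η) := by
  have hc := continuous_hypersurfacePoint (totalOverToProjectiveSpace ℂ 2 p)
  have hopen : IsOpen {q : ℙ ℂ (Fin (2 + 2) → ℂ) | q ∈ (Projectivization.stdChart (𝕜 := ℂ) (2 : Fin 4)).source ∧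
      ‖Projectivization.stdChart (𝕜 := ℂ) (2 : Fin 4) q‖ < η} := by
    have h := (Projectivization.stdChart (𝕜 := ℂ) (2 : Fin 4)).continuousOn.isOpen_inter_preimage
      (Projectivization.stdChart (𝕜 := ℂ) (2 : Fin 4)).open_source (Metric.isOpen_ball (x := (0 : Fin 3 → ℂ)) (ε := η))
    convert h using 1
    ext q
    simp [Metric.mem_ball, dist_zero_right]
  exact hopen.preimage hc

/-- A point of `𝒴(ℂ)` with homogeneous coordinates `[0:0:1:0]` lies in `N_η` (`η > 0`). [cite: CarlsonToledo1999, §6] -/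
theorem mem_nodeNbhd_of_hypersurfacePoint_eq_node (hη : 0 < η) {P : ComplexPoints (totalSpaceOver ℂ 2 p)}
    (hP : hypersurfacePoint (totalOverToProjectiveSpace ℂ 2 p) P = Projectivization.mk ℂ (Pi.single (2 : Fin 4) (1 : ℂ)) (by simp)) :
    P ∈ nodeNbhd p η := by
  refine ⟨?_, ?_⟩
  · rw [hP, Projectivization.stdChart_source, Projectivization.mk_mem_stdChartSource_iff]
    simp
  · rw [hP, Projectivization.stdChart_apply, Projectivization.stdChartFun_mk]
    have h0 : (fun j : Fin 3 => (Pi.single (2 : Fin 4) (1 : ℂ) : Fin 4 → ℂ) ((2 : Fin 4).succAbove j) /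
        (Pi.single (2 : Fin 4) (1 : ℂ) : Fin 4 → ℂ) 2) = 0 := by
      funext j
      have hne : (2 : Fin 4).succAbove j ≠ 2 := Fin.succAbove_ne 2 j
      simp [hne]
    rw [h0, norm_zero]
    exact hη

/-- **For `Q ∈ 𝒴°(ℂ)`: `ι(Q) ∈ N_η ↔ Q ∈ 𝒴°(ℂ)₂ ∧ ‖y(Q)‖ < η`.** [cite: CarlsonToledo1999, §6] -/
theorem map_mem_nodeNbhd_iff (Q : ComplexPoints (regularTotal ℂ 2 p)) :
    AlgPoints.map (regularToTotalSpaceOver ℂ 2 p) Q ∈ nodeNbhd p η ↔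
      Q ∈ regChartDom 2 p 2 ∧ ‖(fun j => regChartFun 2 p 2 Q (Sum.inr j))‖ < η := by
  unfold nodeNbhd
  rw [Set.mem_setOf_eq, hypersurfacePoint_map_regularToTotalSpaceOver, regChartDom_eq_preimage, Set.mem_preimage]
  rfl

/-- **An open `V ∋ b₀` over which every fibre-singular point lies in `N_η`** (`p ≥ 3`, `η > 0`, `b₀ = coeffs(x₃^p − f₁)`).
[cite: CarlsonToledo1999, §6 (kdoublept)] -/
theorem exists_coeff_nhds_singular_subset_nodeNbhd (hp : 3 ≤ p) (hη : 0 < η) :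
    ∃ V : Set (DegIndex 2 p → ℂ), IsOpen V ∧
      coeffsOf 2 p (cyclicCoverForm p (X 2 ^ (p - 2) * (X 0 * X 1) + X 0 ^ p + X 1 ^ p)) ∈ V ∧
      ∀ P : ComplexPoints (totalSpaceOver ℂ 2 p),
        P ∉ Set.range (AlgPoints.map (regularToTotalSpaceOver ℂ 2 p) : ComplexPoints (regularTotal ℂ 2 p) → _) →
          tCoeff ℂ 2 p P ∈ V → P ∈ nodeNbhd p η :=
  exists_open_nhds_singular_subset 2 p (isOpen_nodeNbhd p η) fun _ hP hPb =>
    mem_nodeNbhd_of_hypersurfacePoint_eq_node p η hη (hypersurfacePoint_eq_node_of_singular p hp hP hPb)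

/-- **The support region is compact**: for compact `K ⊆ V` (`V` as above), `{Q ∈ 𝒴°(ℂ) | b(Q) ∈ K, ι(Q) ∉ N_η}` is compact.
[cite: LeeSmoothManifolds2013, Thm. 9.16] -/
theorem isCompact_supportRegion {K V : Set (DegIndex 2 p → ℂ)} (hK : IsCompact K) (hKV : K ⊆ V)
    (hV : ∀ P : ComplexPoints (totalSpaceOver ℂ 2 p),
      P ∉ Set.range (AlgPoints.map (regularToTotalSpaceOver ℂ 2 p) : ComplexPoints (regularTotal ℂ 2 p) → _) →
        tCoeff ℂ 2 p P ∈ V → P ∈ nodeNbhd p η) :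
    IsCompact {Q : ComplexPoints (regularTotal ℂ 2 p) |
      regCoeff ℂ 2 p Q ∈ K ∧ AlgPoints.map (regularToTotalSpaceOver ℂ 2 p) Q ∉ nodeNbhd p η} :=
  isCompact_setOf_regCoeff_mem_of_forall_singular 2 p hK (isOpen_nodeNbhd p η) fun P hP hPK => hV P hP (hKV hPK)

end Literature.AlgebraicGeometry.HodgeTheory

end
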